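import Literature.Geometry.Symplectic.NearSymplecticDefinite
import HarnessLib

/-!
# `relNearSymplecticTaubesTubes_exists` from (G) and (H), strictly near-symplectic version

Topic `Literature/Geometry/Symplectic` (groundwork `--supports`
`Literature.Geometry.Symplectic.relNearSymplecticTaubesTubes_exists`; everything here is PROVED,
no named fact is introduced).

`NearSymplecticTwoCirclesReduction.lean` proves the named fact from two hypotheses (G) (Gerig 2021,
Thm. 1.6 with §3: an asymptotically standard near-symplectic form on `Σ ∖ p` with exactly two
even zero circles) and (H) (Honda 2004, §4 Thm. 5 / Perutz 2006, Lemma 3.1: normal form along an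
even zero circle), both phrased with `IsNearSymplectic`, the verbatim transcription of Perutz
2006, Def. 1.1.  `NearSymplecticDefinite.lean` shows that Def. 1.1 as printed is strictly weaker
than the definite notion under which (H) is actually proved in the literature
(`perutzDegenerateForm`).  This file restates the reduction with BOTH hypotheses phrased for
`IsStrictlyNearSymplectic` — (G') is still Gerig's theorem (his forms are transverse self-dual
harmonic sections, hence strictly near-symplectic; Gerig 2021, §2–§3 via Taubes and Perutz 2006,
Lemma 2.1 (a)), and (H') is exactly Honda 2004, Thm. 5 / Perutz 2006, Lemma 3.1 with its footnote
— and proves `relNearSymplecticTaubesTubes_exists` from (G') and (H')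
(`relNearSymplecticTaubesTubes_exists_of_twoEvenCircles_of_hondaNormalForm_strict`), by the same
glue (separation of the two circles and the puncture, two applications of (H'), locality of
evenness and of Honda charts, shrinking of the ball, non-degeneracy off the zero set).

## References

* C. Gerig, *No homotopy 4-sphere invariants using ECH=SWF*, Algebr. Geom. Topol. 21 (2021),
  Thm. 1.6, §1, §3 [Gerig2021NoHomotopySphereInvariants].
* K. Honda, *Local properties of self-dual harmonic 2-forms on a 4-manifold*, J. reine angew.
  Math. 577 (2004), §4 Thm. 4 (A), Thm. 5 [Honda2004LocalSD].
* T. Perutz, *Zero-sets of near-symplectic forms*, J. Symplectic Geom. 4 (2006), Def. 1.1,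
  Lemma 2.1, Prop. 2.2, Lemma 3.1 [Perutz2006].
-/

noncomputable section

open scoped Manifold ContDiff Topology Real
open Set Function Filter Literature.Geometry.Kaehler Literature.Topology.FourManifolds

namespace Literature.Geometry.Symplectic

/-- Local notation for the model space `ℝ⁴ = EuclideanSpace ℝ (Fin 4)`. -/
local notation "E4" => EuclideanSpace ℝ (Fin 4)

/-- **`relNearSymplecticTaubesTubes_exists` from (G') two even zero circles of a STRICTLY
near-symplectic asymptotically standard form and (H') Honda's normal form along an even zero
circle of a STRICTLY near-symplectic form**: if
(G') for every homotopy `4`-sphere `Σ` and `p ∈ Σ` there are `ε > 0` with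
`closedBall (e p) ε ⊆ e.target`, an orientation `o` of `Σ ∖ p`, a strictly `o`-near-symplectic
`2`-form `sf` on `Σ ∖ p` standard on the punctured `ε`-chart-ball, and two even zero circles
`γ₁, γ₂` of `sf` with disjoint ranges exhausting the zero locus of `sf` (Gerig 2021, Thm. 1.6,
§1 p. 4, §3 par. 1 with `N = 2`; Perutz 2006, Thm. 1.4, Thm. 1.8; the forms are transverse
self-dual harmonic sections, Perutz 2006, Lemma 2.1 (a)); and
(H') on every punctured homotopy `4`-sphere, every strictly `o`-near-symplectic form `sf` with an
even zero circle `γ` can be replaced, inside any open `N ⊇ γ(ℝ)`, by a strictly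
`o`-near-symplectic form `sf'` with `sf' = sf` off `N`, the same zero locus, and a Honda model
chart of some radius `r > 0` inside `N` whose axis image is `γ(ℝ)` (Honda 2004, §4 Thm. 5 with
Thm. 4 (A); Perutz 2006, Lemma 3.1 and footnote);
then `relNearSymplecticTaubesTubes_exists` holds. [cite: Gerig2021NoHomotopySphereInvariants, Thm. 1.6 and §3 (first par.)] -/
theorem relNearSymplecticTaubesTubes_exists_of_twoEvenCircles_of_hondaNormalForm_strict
    (hG : ∀ (S : Literature.Topology.FourManifolds.HomotopySphere 4) (p : S.carrier),
      ∃ (ε : ℝ) (o : SmoothOrientation (𝓡 4) (punctured p))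
        (sf : MForm (𝓡 4) (punctured p) ℝ 2) (γ₁ γ₂ : ℝ → punctured p),
        0 < ε ∧ Metric.closedBall (extChartAt (𝓡 4) p p) ε ⊆ (extChartAt (𝓡 4) p).target ∧
        IsStrictlyNearSymplectic o sf ∧ IsStandardOnBall p ε sf ∧
        IsEvenZeroCircle sf γ₁ ∧ IsEvenZeroCircle sf γ₂ ∧ Disjoint (range γ₁) (range γ₂) ∧
        zeroLocus sf = range γ₁ ∪ range γ₂)
    (hH : ∀ (S : Literature.Topology.FourManifolds.HomotopySphere 4) (p : S.carrier)
      (o : SmoothOrientation (𝓡 4) (punctured p)) (sf : MForm (𝓡 4) (punctured p) ℝ 2)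
      (γ : ℝ → punctured p) (N : Set (punctured p)),
      IsStrictlyNearSymplectic o sf → IsEvenZeroCircle sf γ → IsOpen N → range γ ⊆ N →
      ∃ (sf' : MForm (𝓡 4) (punctured p) ℝ 2) (r : ℝ) (χ : E4 → punctured p),
        IsStrictlyNearSymplectic o sf' ∧ (∀ x : punctured p, x ∉ N → sf' x = sf x) ∧
        zeroLocus sf' = zeroLocus sf ∧ 0 < r ∧ IsHondaModelChartIn N r sf' χ ∧
        χ '' hondaAxis = range γ) :
    relNearSymplecticTaubesTubes_exists := by
  refine relNearSymplecticTaubesTubes_exists_of_hondaModelCharts fun S p => ?_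
  obtain ⟨ε, o, sf, γ₁, γ₂, hε, hball, hns, hstd, h₁, h₂, hdisj, hZ⟩ := hG S p
  -- Step 0: separate the two circles and the puncture in `Σ`
  set K₁ : Set S.carrier := Subtype.val '' range γ₁ with hK₁
  set K₂ : Set S.carrier := Subtype.val '' range γ₂ with hK₂
  have hK₁c : IsCompact K₁ := h₁.isZeroCircle.isCompact_range.image continuous_subtype_val
  have hK₂c : IsCompact K₂ := h₂.isZeroCircle.isCompact_range.image continuous_subtype_val
  have hpK₁ : p ∉ K₁ := by rintro ⟨x, -, hx⟩; exact (mem_punctured.1 x.2) hx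
  have hpK₂ : p ∉ K₂ := by rintro ⟨x, -, hx⟩; exact (mem_punctured.1 x.2) hx
  have hK₁₂ : Disjoint K₁ K₂ := by
    rw [hK₁, hK₂, disjoint_image_iff Subtype.val_injective]; exact hdisj
  obtain ⟨U₁, U₂, hU₁o, hU₂o, hKU₁, hKU₂, hU₁₂⟩ :=
    SeparatedNhds.of_isCompact_isCompact hK₁c hK₂c hK₁₂
  obtain ⟨V₁, W₁, hV₁o, hW₁o, hKV₁, hpW₁, hVW₁⟩ :=
    SeparatedNhds.of_isCompact_isCompact hK₁c isCompact_singleton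
      (disjoint_singleton_right.2 hpK₁)
  obtain ⟨V₂, W₂, hV₂o, hW₂o, hKV₂, hpW₂, hVW₂⟩ :=
    SeparatedNhds.of_isCompact_isCompact hK₂c isCompact_singleton
      (disjoint_singleton_right.2 hpK₂)
  -- the open sets of `Σ ∖ p` in which (H') is applied
  set N₁ : Set (punctured p) := Subtype.val ⁻¹' (U₁ ∩ V₁) with hN₁
  set N₂ : Set (punctured p) := Subtype.val ⁻¹' (U₂ ∩ V₂) with hN₂
  have hN₁o : IsOpen N₁ := (hU₁o.inter hV₁o).preimage continuous_subtype_val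
  have hN₂o : IsOpen N₂ := (hU₂o.inter hV₂o).preimage continuous_subtype_val
  have hγN₁ : range γ₁ ⊆ N₁ := fun x hx =>
    ⟨hKU₁ ⟨x, hx, rfl⟩, hKV₁ ⟨x, hx, rfl⟩⟩
  have hγN₂ : range γ₂ ⊆ N₂ := fun x hx =>
    ⟨hKU₂ ⟨x, hx, rfl⟩, hKV₂ ⟨x, hx, rfl⟩⟩
  have hN₁₂ : Disjoint N₁ N₂ := by
    rw [hN₁, hN₂, Set.disjoint_left]
    intro x hx hx'
    exact Set.disjoint_left.1 hU₁₂ hx.1 hx'.1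
  -- Step 1: Honda's normal form along `γ₁` inside `N₁`
  obtain ⟨sf₁, r₁, χ₁, hns₁, heq₁, hZ₁, hr₁, hc₁, hax₁⟩ := hH S p o sf γ₁ N₁ hns h₁ hN₁o hγN₁
  -- `γ₂` is still an even zero circle of `sf₁` (the form is unchanged on `N₂`)
  have h₂' : IsEvenZeroCircle sf₁ γ₂ :=
    h₂.congr hN₂o hγN₂ fun x hx => heq₁ x (Set.disjoint_right.1 hN₁₂ hx)
  -- Step 2: Honda's normal form along `γ₂` inside `N₂`
  obtain ⟨sf₂, r₂, χ₂, hns₂, heq₂, hZ₂, hr₂, hc₂, hax₂⟩ :=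
    hH S p o sf₁ γ₂ N₂ hns₁ h₂' hN₂o hγN₂
  -- the first chart survives (the form is unchanged on `N₁`)
  have hc₁' : IsHondaModelChartIn N₁ r₁ sf₂ χ₁ :=
    hc₁.congr fun x hx => heq₂ x (Set.disjoint_left.1 hN₁₂ hx)
  -- Step 3: shrink the ball into `W₁ ∩ W₂`, which misses `N₁ ∪ N₂`
  obtain ⟨ε', hε', hε'ε, hballW⟩ := exists_puncturedChartBall_subset (p := p) hε
    ((hW₁o.inter hW₂o).mem_nhds ⟨hpW₁ rfl, hpW₂ rfl⟩)
  have hN₁ball : ∀ x ∈ N₁, ¬ InPuncturedChartBall p ε' x := fun x hx hb =>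
    Set.disjoint_left.1 hVW₁ hx.2 (hballW x hb).1
  have hN₂ball : ∀ x ∈ N₂, ¬ InPuncturedChartBall p ε' x := fun x hx hb =>
    Set.disjoint_left.1 hVW₂ hx.2 (hballW x hb).2
  -- common radius
  set r : ℝ := min r₁ r₂ with hr_def
  have hr : 0 < r := lt_min hr₁ hr₂
  have hC₁ : IsHondaModelChart p ε' r sf₂ χ₁ :=
    (hc₁'.mono_radius hr.le (min_le_left _ _)).isHondaModelChart hN₁ball
  have hC₂ : IsHondaModelChart p ε' r sf₂ χ₂ :=
    (hc₂.mono_radius hr.le (min_le_right _ _)).isHondaModelChart hN₂ball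
  refine ⟨ε', r, sf₂, χ₁, χ₂, hε', (Metric.closedBall_subset_closedBall hε'ε).trans hball, hr,
    hns₂.isSmoothForm, hns₂.isClosedForm, ?_, hC₁, hC₂, ?_, ?_⟩
  · -- standard on the smaller ball: there `sf₂ = sf₁ = sf`
    intro x hx v w
    have hx₁ : x ∉ N₁ := fun h => hN₁ball x h hx
    have hx₂ : x ∉ N₂ := fun h => hN₂ball x h hx
    rw [heq₂ x hx₂, heq₁ x hx₁]
    exact hstd.anti hε'ε x hx v w
  · -- the tube images are disjoint: they lie in `N₁`, `N₂`
    refine hN₁₂.mono ?_ ?_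
    · exact (image_mono (hondaTube_mono hr.le (min_le_left _ _))).trans hc₁.image_subset
    · exact (image_mono (hondaTube_mono hr.le (min_le_right _ _))).trans hc₂.image_subset
  · -- non-degenerate off the two axes = off the (unchanged) zero locus
    intro x hx v hv
    refine hns₂.isNearSymplectic.nondegenerate_of_not_mem ?_ v hv
    rw [hZ₂, hZ₁, hZ]
    rintro (hx' | hx')
    · exact hx (Or.inl (hax₁ ▸ hx'))
    · exact hx (Or.inr (hax₂ ▸ hx'))

/-- **A form with a Honda model chart has no zeros in the tube image off the axis image**
(`χ^* sf = ω_A` and `ω_A(q) ≠ 0` off the axis): the bookkeeping behind "the same zero locus" in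
(H'). [cite: Honda2004LocalSD, §4 Thm. 4 (A)] -/
theorem IsHondaModelChartIn.apply_ne_zero_of_not_mem_hondaAxis
    {M : Type*} [TopologicalSpace M] [ChartedSpace E4 M]
    {sf : MForm (𝓡 4) M ℝ 2} {N : Set M} {r : ℝ} {χ : E4 → M}
    (h : IsHondaModelChartIn N r sf χ) {q : E4} (hq : q ∈ hondaTube r) (hq' : q ∉ hondaAxis) :
    sf (χ q) ≠ 0 := by
  intro hzero
  obtain ⟨V, W, hVW⟩ : ∃ V W : E4, hondaFormA q V W ≠ 0 := by
    by_contra hall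
    push Not at hall
    exact hq' ((forall_hondaFormA_eq_zero_iff q).1 hall)
  apply hVW
  rw [← h.pullback_eq q hq V W, hzero]
  rfl

end Literature.Geometry.Symplectic

end
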